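import Summits.Parity.BatemanHorn.Theorems.SoloInformedQuadraticSquares
import Summits.Parity.BatemanHorn.Theorems.SoloInformedPolynomialPrimeCount

/-!
# SoloInformedQuadraticPrimeCount — the `π`-level localisation for every QUADRATIC Bateman–Horn polynomial

Solo unit `solo-Parity-informed` (ideation tier, informed mode), session 12; `PLAN.md` §20, CLAIMS C54.

For `g ∈ ℤ[X]` with `IsBatemanHornSystem ![g]` and `deg g = 2` (the Conjecture-F family: `n² + 1`,
`n² + n + 41`, …) the proper-prime-power term is negligible UNCONDITIONALLY:

  `PP_g(x) = ∑_{1 ≤ n ≤ x, |g(n)| not prime} Λ(|g(n)|) = o(x)`   (`properPrimePow_sum_isLittleO_of_natDegree_two`):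

a value `|g(n)| = p^k`, `k ≥ 2`, is either a perfect square (`k = 2`; these `n` are `o(x / log x)` by the square
sieve `SoloInformedQuadraticSquares`) or has `k ≥ 3`, `p ≤ (e^B x²)^{1/3}` (at most `O(x^{2/3} log x)` values, each
taken `≤ 4` times), and `Λ(|g(n)|) ≤ 2 log x + B`.  Consequently (with `SoloInformedPolynomialPrimeCount`):

* `batemanHornAsymptotic_iff_isEquivalent_psi_of_natDegree_two` —
    `BatemanHornAsymptotic ![g] ⟺ ∑_{n ≤ x} Λ(|g(n)|) ~ C(g) x`;
* `batemanHornAsymptotic_iff_largeDivisorSum_isLittleO_of_natDegree_two` (every admissible cut `y`) and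
  `batemanHornAsymptotic_iff_largeDivisorSum_isLittleO_rpowCut_of_natDegree_two` (`y = x^{1-ε}`, `0 < ε < 1`) —
    `BatemanHornAsymptotic ![g] ⟺ T_g(x; y) = ∑_{n ≤ x} ∑_{d ∣ |g(n)|, d > y} μ(d) log d = o(x)`.

So for every quadratic Bateman–Horn polynomial the conjunct's instance is EXACTLY the cancellation of `μ · log`
over the large divisors of the values — unconditionally, at the level of `π_g(x)` itself.
No bearing on the truth of the conjecture.
-/

namespace Summit.Parity.BatemanHorn.Theorems

open Finset Filter ArithmeticFunction Asymptotics Polynomial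
open scoped ArithmeticFunction.Moebius Topology
open Literature.NumberTheory.Sieve (IsBatemanHornSystem batemanHornConst BatemanHornAsymptotic)

/-! ### Fibres of a polynomial -/

/-- A non-constant `g ∈ ℤ[X]` takes each value at most `deg g` times on `ℕ`. -/
theorem card_filter_eval_eq_le (g : ℤ[X]) (hdeg : 0 < g.natDegree) (s : Finset ℕ) (c : ℤ) :
    #(s.filter fun n : ℕ => g.eval (n : ℤ) = c) ≤ g.natDegree := by
  have hgc : g - C c ≠ 0 := by
    intro h
    have h' := congrArg natDegree h
    rw [natDegree_sub_C, natDegree_zero] at h'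
    omega
  calc #(s.filter fun n : ℕ => g.eval (n : ℤ) = c)
      ≤ #((g - C c).roots.toFinset) := by
        refine card_le_card_of_injOn (fun n : ℕ => (n : ℤ)) ?_ ?_
        · intro n hn
          simp only [coe_filter, Set.mem_setOf_eq] at hn
          rw [mem_coe, Multiset.mem_toFinset, mem_roots hgc, IsRoot.def, eval_sub, eval_C, hn.2, sub_self]
        · intro a _ b _ h
          simpa using h
    _ ≤ g.natDegree :=
        (Multiset.toFinset_card_le _).trans (card_roots_sub_C' (natDegree_pos_iff_degree_pos.mp hdeg))

/-- … hence `|g(n)| = m` for at most `2 deg g` values of `n`. -/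
theorem card_filter_natAbs_eval_eq_le (g : ℤ[X]) (hdeg : 0 < g.natDegree) (s : Finset ℕ) (m : ℕ) :
    #(s.filter fun n : ℕ => (g.eval (n : ℤ)).natAbs = m) ≤ 2 * g.natDegree := by
  have h1 := card_filter_eval_eq_le g hdeg s m
  have h2 := card_filter_eval_eq_le g hdeg s (-m)
  calc #(s.filter fun n : ℕ => (g.eval (n : ℤ)).natAbs = m)
      ≤ #(s.filter (fun n : ℕ => g.eval (n : ℤ) = m) ∪ s.filter (fun n : ℕ => g.eval (n : ℤ) = -m)) := by
        refine card_le_card fun n hn => ?_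
        rw [mem_filter] at hn
        rw [mem_union, mem_filter, mem_filter]
        rcases Int.natAbs_eq_iff.mp hn.2 with h | h
        · exact Or.inl ⟨hn.1, h⟩
        · exact Or.inr ⟨hn.1, h⟩
    _ ≤ 2 * g.natDegree := (card_union_le _ _).trans (by omega)

/-- `#{n ∈ s : |g(n)| = m^k for some m ≤ P, k ≤ K} ≤ (P + 1)(K + 1) · 2 deg g`. -/
theorem card_biUnion_natAbs_eval_eq_pow_le (g : ℤ[X]) (hdeg : 0 < g.natDegree) (s : Finset ℕ) (P K : ℕ) :
    #((range (P + 1)).biUnion fun m : ℕ => (range (K + 1)).biUnion fun k : ℕ =>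
        s.filter fun n : ℕ => (g.eval (n : ℤ)).natAbs = m ^ k) ≤ (P + 1) * (K + 1) * (2 * g.natDegree) := by
  calc #((range (P + 1)).biUnion fun m : ℕ => (range (K + 1)).biUnion fun k : ℕ =>
        s.filter fun n : ℕ => (g.eval (n : ℤ)).natAbs = m ^ k)
      ≤ ∑ m ∈ range (P + 1), ∑ k ∈ range (K + 1),
          #(s.filter fun n : ℕ => (g.eval (n : ℤ)).natAbs = m ^ k) :=
        card_biUnion_le.trans (sum_le_sum fun m _ => card_biUnion_le)
    _ ≤ ∑ m ∈ range (P + 1), ∑ k ∈ range (K + 1), 2 * g.natDegree :=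
        sum_le_sum fun m _ => sum_le_sum fun k _ => card_filter_natAbs_eval_eq_le g hdeg s (m ^ k)
    _ = (P + 1) * (K + 1) * (2 * g.natDegree) := by
        simp only [sum_const, card_range, smul_eq_mul]
        ring

/-! ### The proper-prime-power term: a counting bound -/

/-- **`PP_g(x) ≤ (2 log x + B) · (n₀ + #squares + #higher powers)`** for a quadratic `g` with `g(n) > 0` for
`n ≥ n₀` and `|log |g(n)| - 2 log n| ≤ B`: a value with `Λ(|g(n)|) ≠ 0`, `|g(n)|` not prime, is `p^k` with
`k ≥ 2` — a square if `k = 2` and `n ≥ n₀`, else `p ≤ (e^B x²)^{1/3}` and `k ≤ log(e^B x²)/log 2`. -/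
theorem properPrimePow_polyVal_sum_le (g : ℤ[X]) (hdeg : g.natDegree = 2) {n₀ : ℕ}
    (hpos : ∀ n : ℕ, n₀ ≤ n → 0 < g.eval (n : ℤ)) {B : ℝ}
    (hB : ∀ n : ℕ, 1 ≤ n → |Real.log ((g.eval (n : ℤ)).natAbs : ℝ) - g.natDegree * Real.log n| ≤ B)
    {x : ℕ} (hx : 1 ≤ x) :
    ∑ n ∈ (Icc 1 x).filter (fun n : ℕ => ¬Nat.Prime (g.eval (n : ℤ)).natAbs), Λ (g.eval (n : ℤ)).natAbs
      ≤ (2 * Real.log x + B) * (n₀ + #((Icc 1 x).filter fun n : ℕ => IsSquare (g.eval (n : ℤ)))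
          + #((range (⌊(Real.exp B * (x : ℝ) ^ 2) ^ (1 / 3 : ℝ)⌋₊ + 1)).biUnion fun m : ℕ =>
              (range (⌊Real.log (Real.exp B * (x : ℝ) ^ 2) / Real.log 2⌋₊ + 1)).biUnion fun k : ℕ =>
                (Icc 1 x).filter fun n : ℕ => (g.eval (n : ℤ)).natAbs = m ^ k)) := by
  set Y : ℝ := Real.exp B * (x : ℝ) ^ 2 with hY
  set P := ⌊Y ^ (1 / 3 : ℝ)⌋₊ with hP
  set K := ⌊Real.log Y / Real.log 2⌋₊ with hK
  set NP := (Icc 1 x).filter (fun n : ℕ => ¬Nat.Prime (g.eval (n : ℤ)).natAbs) with hNP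
  set SQ := (Icc 1 x).filter (fun n : ℕ => IsSquare (g.eval (n : ℤ))) with hSQ
  set CU := (range (P + 1)).biUnion (fun m : ℕ => (range (K + 1)).biUnion fun k : ℕ =>
    (Icc 1 x).filter fun n : ℕ => (g.eval (n : ℤ)).natAbs = m ^ k) with hCU
  have hx0 : (0 : ℝ) < x := by exact_mod_cast hx
  have hlogx : 0 ≤ Real.log x := Real.log_nonneg (by exact_mod_cast hx)
  have hY0 : 0 < Y := by positivity
  have hlog2 : 0 < Real.log 2 := Real.log_pos (by norm_num)
  -- pointwise bound for the weights
  have hw : ∀ n ∈ NP.filter (fun n : ℕ => Λ (g.eval (n : ℤ)).natAbs ≠ 0),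
      Λ (g.eval (n : ℤ)).natAbs ≤ 2 * Real.log x + B := by
    intro n hn
    obtain ⟨hn, -⟩ := mem_filter.mp hn
    obtain ⟨hn1, hnx⟩ := mem_Icc.mp (mem_filter.mp hn).1
    have h1 := (abs_le.mp (hB n hn1)).2
    rw [hdeg] at h1
    have h2 : Real.log n ≤ Real.log x :=
      Real.log_le_log (by exact_mod_cast hn1) (by exact_mod_cast hnx)
    push_cast at h1
    linarith [vonMangoldt_le_log (n := (g.eval (n : ℤ)).natAbs)]
  -- where the non-zero weights live
  have hsub : NP.filter (fun n : ℕ => Λ (g.eval (n : ℤ)).natAbs ≠ 0) ⊆ range n₀ ∪ SQ ∪ CU := by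
    intro n hn
    obtain ⟨hnNP, hΛ⟩ := mem_filter.mp hn
    obtain ⟨hnI, hnp⟩ := mem_filter.mp hnNP
    obtain ⟨hn1, hnx⟩ := mem_Icc.mp hnI
    obtain ⟨p, k, hp, hk, hpk⟩ := (isPrimePow_nat_iff _).mp (vonMangoldt_ne_zero_iff.mp hΛ)
    rw [mem_union, mem_union]
    by_cases hn0 : n < n₀
    · exact Or.inl (Or.inl (mem_range.mpr hn0))
    have hgpos : 0 < g.eval (n : ℤ) := hpos n (not_lt.mp hn0)
    have hk1 : k ≠ 1 := by
      rintro rfl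
      rw [pow_one] at hpk
      exact hnp (hpk ▸ hp)
    by_cases hk2 : k = 2
    · -- a square
      refine Or.inl (Or.inr (mem_filter.mpr ⟨hnI, (p : ℤ), ?_⟩))
      rw [← Int.natAbs_of_nonneg hgpos.le, ← hpk, hk2]
      push_cast
      ring
    · -- a higher power: `p ≤ P`, `k ≤ K`
      have hk3 : 3 ≤ k := by omega
      have hgY : (((g.eval (n : ℤ)).natAbs : ℕ) : ℝ) ≤ Y := by
        have h1 := (abs_le.mp (hB n hn1)).2
        rw [hdeg] at h1
        push_cast at h1
        have h2 : Real.log n ≤ Real.log x :=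
          Real.log_le_log (by exact_mod_cast hn1) (by exact_mod_cast hnx)
        have hg0 : (0 : ℝ) < ((g.eval (n : ℤ)).natAbs : ℕ) := by
          rw [← hpk]
          exact_mod_cast pow_pos hp.pos k
        rw [← Real.exp_log hg0, hY, show Real.exp B * (x : ℝ) ^ 2 = Real.exp (Real.log ((x : ℝ) ^ 2) + B) by
          rw [Real.exp_add, Real.exp_log (by positivity), mul_comm]]
        refine Real.exp_le_exp.mpr ?_
        rw [Real.log_pow]
        push_cast
        linarith
      have hpkR : ((p : ℝ) ^ k) = (((g.eval (n : ℤ)).natAbs : ℕ) : ℝ) := by exact_mod_cast hpk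
      have hpP : p ∈ range (P + 1) := by
        rw [mem_range, Nat.lt_add_one_iff, hP]
        refine Nat.le_floor ?_
        have h3 : (p : ℝ) ^ 3 ≤ Y := by
          calc (p : ℝ) ^ 3 ≤ (p : ℝ) ^ k := pow_le_pow_right₀ (by exact_mod_cast hp.one_lt.le) hk3
            _ ≤ Y := hpkR ▸ hgY
        have hroot : ((p : ℝ) ^ 3) ^ (1 / 3 : ℝ) = p := by
          rw [one_div, show (3 : ℝ)⁻¹ = ((3 : ℕ) : ℝ)⁻¹ by norm_num]
          exact Real.pow_rpow_inv_natCast (Nat.cast_nonneg p) (by norm_num)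
        calc (p : ℝ) = ((p : ℝ) ^ 3) ^ (1 / 3 : ℝ) := hroot.symm
          _ ≤ Y ^ (1 / 3 : ℝ) := Real.rpow_le_rpow (by positivity) h3 (by norm_num)
      have hkK : k ∈ range (K + 1) := by
        rw [mem_range, Nat.lt_add_one_iff, hK]
        refine Nat.le_floor ?_
        rw [le_div_iff₀ hlog2]
        have h2k : (2 : ℝ) ^ k ≤ Y := by
          calc (2 : ℝ) ^ k ≤ (p : ℝ) ^ k := pow_le_pow_left₀ (by norm_num) (by exact_mod_cast hp.two_le) k
            _ ≤ Y := hpkR ▸ hgY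
        have := Real.log_le_log (by positivity) h2k
        rwa [Real.log_pow] at this
      exact Or.inr (mem_biUnion.mpr ⟨p, hpP, mem_biUnion.mpr ⟨k, hkK, mem_filter.mpr ⟨hnI, hpk.symm⟩⟩⟩)
  -- sum ≤ (max weight) · (number of non-zero weights)
  have hcard : (#(NP.filter fun n : ℕ => Λ (g.eval (n : ℤ)).natAbs ≠ 0) : ℝ) ≤ n₀ + #SQ + #CU := by
    have h := (card_le_card hsub).trans ((card_union_le _ _).trans
      (Nat.add_le_add_right (card_union_le _ _) _))
    rw [card_range] at h
    exact_mod_cast h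
  calc ∑ n ∈ NP, Λ (g.eval (n : ℤ)).natAbs
      = ∑ n ∈ NP.filter (fun n : ℕ => Λ (g.eval (n : ℤ)).natAbs ≠ 0), Λ (g.eval (n : ℤ)).natAbs :=
        (sum_filter_ne_zero NP).symm
    _ ≤ #(NP.filter fun n : ℕ => Λ (g.eval (n : ℤ)).natAbs ≠ 0) • (2 * Real.log x + B) :=
        sum_le_card_nsmul _ _ _ hw
    _ ≤ (2 * Real.log x + B) * (n₀ + #SQ + #CU) := by
        rw [nsmul_eq_mul, mul_comm]
        have hB0 : 0 ≤ B := (abs_nonneg _).trans (hB 1 le_rfl)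
        have hw0 : 0 ≤ 2 * Real.log x + B := by linarith
        gcongr

/-! ### The higher-power count is `O(x^{2/3} log x)`, hence negligible -/

/-- For every `B` and `δ > 0`: eventually `3 log x · 4 (P_x + 1)(K_x + 1) ≤ δ x`, where `P_x = ⌊(e^B x²)^{1/3}⌋`,
`K_x = ⌊log(e^B x²)/log 2⌋`. -/
theorem eventually_higherPow_count_mul_log_le {B : ℝ} (hB0 : 0 ≤ B) {δ : ℝ} (hδ : 0 < δ) :
    ∀ᶠ x : ℕ in atTop, 3 * Real.log x *
      (((⌊(Real.exp B * (x : ℝ) ^ 2) ^ (1 / 3 : ℝ)⌋₊ + 1)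
        * (⌊Real.log (Real.exp B * (x : ℝ) ^ 2) / Real.log 2⌋₊ + 1) * (2 * 2) : ℕ) : ℝ) ≤ δ * x := by
  set c₀ : ℝ := Real.exp (B / 3) with hc₀
  have hc₀0 : 0 < c₀ := Real.exp_pos _
  have hlog2 : 0 < Real.log 2 := Real.log_pos (by norm_num)
  have hlog2' : Real.log 2 < 1 := by
    have := Real.log_two_lt_d9; norm_num at this; linarith
  set η : ℝ := δ * Real.log 2 / (96 * c₀) with hη
  have hη0 : 0 < η := by positivity
  have hlo := ((isLittleO_log_rpow_rpow_atTop 2 (show (0 : ℝ) < 1 / 3 by norm_num)).comp_tendsto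
    tendsto_natCast_atTop_atTop).def hη0
  have hlog : Tendsto (fun x : ℕ => Real.log x) atTop atTop :=
    Real.tendsto_log_atTop.comp tendsto_natCast_atTop_atTop
  filter_upwards [hlo, hlog.eventually (eventually_ge_atTop (max B 1)), eventually_ge_atTop 1]
    with x hx hL hx1
  simp only [Function.comp_apply, Real.norm_eq_abs, Real.rpow_two] at hx
  rw [abs_of_nonneg (sq_nonneg _), abs_of_nonneg (by positivity)] at hx
  set L := Real.log x with hL'
  have hBL : B ≤ L := le_trans (le_max_left _ _) hL
  have hL1 : 1 ≤ L := le_trans (le_max_right _ _) hL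
  have hL0 : 0 ≤ L := by linarith
  have hx0 : (0 : ℝ) < x := by exact_mod_cast hx1
  have hlog2ne : Real.log 2 ≠ 0 := hlog2.ne'
  -- `Y^{1/3} = c₀ x^{2/3}`, `log Y = B + 2 L`
  have hY3 : (Real.exp B * (x : ℝ) ^ 2) ^ (1 / 3 : ℝ) = c₀ * (x : ℝ) ^ (2 / 3 : ℝ) := by
    rw [Real.mul_rpow (Real.exp_pos _).le (by positivity), hc₀, ← Real.exp_mul,
      show ((x : ℝ) ^ 2) = (x : ℝ) ^ (2 : ℝ) by rw [Real.rpow_two], ← Real.rpow_mul hx0.le,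
      show B * (1 / 3 : ℝ) = B / 3 by ring, show (2 : ℝ) * (1 / 3) = 2 / 3 by norm_num]
  have hlogY : Real.log (Real.exp B * (x : ℝ) ^ 2) = B + 2 * L := by
    rw [Real.log_mul (Real.exp_pos _).ne' (by positivity), Real.log_exp, Real.log_pow]
    push_cast
    ring
  have hx23 : 1 ≤ c₀ * (x : ℝ) ^ (2 / 3 : ℝ) := by
    have h1 : 1 ≤ c₀ := by rw [hc₀]; exact Real.one_le_exp (by positivity)
    have h2 : (1 : ℝ) ≤ (x : ℝ) ^ (2 / 3 : ℝ) := Real.one_le_rpow (by exact_mod_cast hx1) (by norm_num)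
    nlinarith
  -- the two factors
  have hP : ((⌊(Real.exp B * (x : ℝ) ^ 2) ^ (1 / 3 : ℝ)⌋₊ : ℕ) : ℝ) + 1
      ≤ 2 * (c₀ * (x : ℝ) ^ (2 / 3 : ℝ)) := by
    have hfl := Nat.floor_le (show 0 ≤ (Real.exp B * (x : ℝ) ^ 2) ^ (1 / 3 : ℝ) by positivity)
    linarith [hY3]
  have hK : ((⌊Real.log (Real.exp B * (x : ℝ) ^ 2) / Real.log 2⌋₊ : ℕ) : ℝ) + 1 ≤ 4 * L / Real.log 2 := by
    have hfl := Nat.floor_le (show 0 ≤ Real.log (Real.exp B * (x : ℝ) ^ 2) / Real.log 2 by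
      rw [hlogY]; positivity)
    have e : Real.log (Real.exp B * (x : ℝ) ^ 2) / Real.log 2 + 1 ≤ 4 * L / Real.log 2 := by
      rw [hlogY, div_add_one hlog2ne, div_le_div_iff_of_pos_right hlog2]
      linarith
    linarith
  -- assemble
  have hx' : (x : ℝ) ^ (2 / 3 : ℝ) * (x : ℝ) ^ (1 / 3 : ℝ) = x := by
    rw [← Real.rpow_add hx0]
    norm_num
  calc 3 * L * (((⌊(Real.exp B * (x : ℝ) ^ 2) ^ (1 / 3 : ℝ)⌋₊ + 1)
        * (⌊Real.log (Real.exp B * (x : ℝ) ^ 2) / Real.log 2⌋₊ + 1) * (2 * 2) : ℕ) : ℝ)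
      = 3 * L * ((((⌊(Real.exp B * (x : ℝ) ^ 2) ^ (1 / 3 : ℝ)⌋₊ : ℕ) : ℝ) + 1)
        * (((⌊Real.log (Real.exp B * (x : ℝ) ^ 2) / Real.log 2⌋₊ : ℕ) : ℝ) + 1) * 4) := by
        push_cast
        ring
    _ ≤ 3 * L * ((2 * (c₀ * (x : ℝ) ^ (2 / 3 : ℝ))) * (4 * L / Real.log 2) * 4) := by gcongr
    _ = 96 * c₀ / Real.log 2 * (x : ℝ) ^ (2 / 3 : ℝ) * L ^ 2 := by
        field_simp
        ring
    _ ≤ 96 * c₀ / Real.log 2 * (x : ℝ) ^ (2 / 3 : ℝ) * (η * (x : ℝ) ^ (1 / 3 : ℝ)) := by gcongr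
    _ = δ * ((x : ℝ) ^ (2 / 3 : ℝ) * (x : ℝ) ^ (1 / 3 : ℝ)) := by
        rw [hη]
        field_simp
    _ = δ * x := by rw [hx']

/-! ### `PP_g = o(x)` for quadratic `g` -/

/-- **Proper prime powers among the values of a quadratic Bateman–Horn polynomial are negligible:**
`∑_{1 ≤ n ≤ x, |g(n)| not prime} Λ(|g(n)|) = o(x)`. -/
theorem properPrimePow_sum_isLittleO_of_natDegree_two {g : ℤ[X]} (hg : IsBatemanHornSystem ![g])
    (hdeg : g.natDegree = 2) :
    (fun x : ℕ => ∑ n ∈ (Icc 1 x).filter (fun n : ℕ => ¬Nat.Prime (g.eval (n : ℤ)).natAbs),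
        Λ (g.eval (n : ℤ)).natAbs) =o[atTop] fun x : ℕ => (x : ℝ) := by
  have hirr : Irreducible g := by simpa using hg.irreducible 0
  have hdeg0 : 0 < g.natDegree := by omega
  have hlc : 0 < g.leadingCoeff := by simpa using hg.leadingCoeff_pos 0
  obtain ⟨n₀, hn₀⟩ := exists_eval_natCast_pos hdeg0 hlc
  obtain ⟨B, hB⟩ := exists_abs_log_natAbs_eval_sub_le hdeg0
  have hB0 : 0 ≤ B := (abs_nonneg _).trans (hB 1 le_rfl)
  have ha : g.coeff 2 ≠ 0 := by
    rw [← hdeg, coeff_natDegree]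
    exact hlc.ne'
  have hD := discr_ne_zero_of_irreducible hirr hdeg
  rw [isLittleO_iff]
  intro δ hδ
  have h1 := eventually_card_isSquare_eval_mul_log_le g hdeg.le ha hD (show 0 < δ / 9 by positivity)
  have h2 := eventually_higherPow_count_mul_log_le hB0 (show 0 < δ / 3 by positivity)
  have h3 : ∀ᶠ x : ℕ in atTop, 3 * Real.log x * n₀ ≤ δ / 3 * x := by
    have hlo := (Real.isLittleO_log_id_atTop.comp_tendsto tendsto_natCast_atTop_atTop).def
      (show 0 < δ / (9 * (n₀ + 1)) by positivity)
    filter_upwards [hlo, eventually_ge_atTop 1] with x hx hx1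
    simp only [Function.comp_apply, id_eq, Real.norm_eq_abs] at hx
    rw [abs_of_nonneg (Real.log_nonneg (by exact_mod_cast hx1)), abs_of_nonneg (Nat.cast_nonneg x)] at hx
    have hn : (n₀ : ℝ) ≤ n₀ + 1 := by linarith
    calc 3 * Real.log x * n₀ ≤ 3 * (δ / (9 * (n₀ + 1)) * x) * (n₀ + 1) := by gcongr
      _ = δ / 3 * x := by
          field_simp
          ring
  have hlog : Tendsto (fun x : ℕ => Real.log x) atTop atTop :=
    Real.tendsto_log_atTop.comp tendsto_natCast_atTop_atTop
  filter_upwards [h1, h2, h3, hlog.eventually (eventually_ge_atTop B), eventually_ge_atTop 1]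
    with x hx1 hx2 hx3 hBL hx
  have hL0 : 0 ≤ Real.log x := Real.log_nonneg (by exact_mod_cast hx)
  have hPP0 : 0 ≤ ∑ n ∈ (Icc 1 x).filter (fun n : ℕ => ¬Nat.Prime (g.eval (n : ℤ)).natAbs),
      Λ (g.eval (n : ℤ)).natAbs := sum_nonneg fun n _ => vonMangoldt_nonneg
  rw [Real.norm_eq_abs, Real.norm_eq_abs, abs_of_nonneg hPP0, abs_of_nonneg (Nat.cast_nonneg x)]
  have hmain := properPrimePow_polyVal_sum_le g hdeg hn₀ hB hx
  have hcu := card_biUnion_natAbs_eval_eq_pow_le g hdeg0 (Icc 1 x)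
    ⌊(Real.exp B * (x : ℝ) ^ 2) ^ (1 / 3 : ℝ)⌋₊ ⌊Real.log (Real.exp B * (x : ℝ) ^ 2) / Real.log 2⌋₊
  rw [hdeg] at hcu
  have hcu' : (#((range (⌊(Real.exp B * (x : ℝ) ^ 2) ^ (1 / 3 : ℝ)⌋₊ + 1)).biUnion fun m : ℕ =>
      (range (⌊Real.log (Real.exp B * (x : ℝ) ^ 2) / Real.log 2⌋₊ + 1)).biUnion fun k : ℕ =>
        (Icc 1 x).filter fun n : ℕ => (g.eval (n : ℤ)).natAbs = m ^ k) : ℝ)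
      ≤ (((⌊(Real.exp B * (x : ℝ) ^ 2) ^ (1 / 3 : ℝ)⌋₊ + 1)
        * (⌊Real.log (Real.exp B * (x : ℝ) ^ 2) / Real.log 2⌋₊ + 1) * (2 * 2) : ℕ) : ℝ) := by
    exact_mod_cast hcu
  have h2L : 2 * Real.log x + B ≤ 3 * Real.log x := by linarith
  calc ∑ n ∈ (Icc 1 x).filter (fun n : ℕ => ¬Nat.Prime (g.eval (n : ℤ)).natAbs), Λ (g.eval (n : ℤ)).natAbs
      ≤ (3 * Real.log x) * (n₀ + #((Icc 1 x).filter fun n : ℕ => IsSquare (g.eval (n : ℤ)))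
          + (((⌊(Real.exp B * (x : ℝ) ^ 2) ^ (1 / 3 : ℝ)⌋₊ + 1)
            * (⌊Real.log (Real.exp B * (x : ℝ) ^ 2) / Real.log 2⌋₊ + 1) * (2 * 2) : ℕ) : ℝ)) := by
        refine hmain.trans ?_
        have h3L : 0 ≤ 3 * Real.log x := by positivity
        gcongr
    _ = 3 * Real.log x * n₀
          + 3 * (#((Icc 1 x).filter fun n : ℕ => IsSquare (g.eval (n : ℤ))) * Real.log x)
          + 3 * Real.log x * (((⌊(Real.exp B * (x : ℝ) ^ 2) ^ (1 / 3 : ℝ)⌋₊ + 1)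
            * (⌊Real.log (Real.exp B * (x : ℝ) ^ 2) / Real.log 2⌋₊ + 1) * (2 * 2) : ℕ) : ℝ) := by ring
    _ ≤ δ / 3 * x + 3 * (δ / 9 * x) + δ / 3 * x := by gcongr
    _ = δ * x := by ring

/-! ### The localisation for quadratic polynomials -/

/-- **`BatemanHornAsymptotic ![g] ⟺ ∑_{n ≤ x} Λ(|g(n)|) ~ C(g) x`** for every quadratic Bateman–Horn polynomial. -/
theorem batemanHornAsymptotic_iff_isEquivalent_psi_of_natDegree_two {g : ℤ[X]}
    (hg : IsBatemanHornSystem ![g]) (hdeg : g.natDegree = 2) :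
    BatemanHornAsymptotic ![g] ↔
      ((fun x : ℕ => ∑ n ∈ Icc 1 x, Λ (g.eval (n : ℤ)).natAbs) ~[atTop]
        fun x : ℕ => batemanHornConst ![g] * (x : ℝ)) :=
  batemanHornAsymptotic_iff_isEquivalent_psi_of_properPrimePow hg
    (properPrimePow_sum_isLittleO_of_natDegree_two hg hdeg)

/-- **`BatemanHornAsymptotic ![g] ⟺ T_g(x; y) = o(x)`** for every quadratic Bateman–Horn polynomial and every
admissible cut `y → ∞`, `y log y = o(x)`. -/
theorem batemanHornAsymptotic_iff_largeDivisorSum_isLittleO_of_natDegree_two {g : ℤ[X]}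
    (hg : IsBatemanHornSystem ![g]) (hdeg : g.natDegree = 2)
    {y : ℕ → ℕ} (hy : Tendsto y atTop atTop)
    (hy' : (fun x : ℕ => Real.log (y x) * (y x : ℝ)) =o[atTop] fun x : ℕ => (x : ℝ)) :
    BatemanHornAsymptotic ![g] ↔
      (fun x : ℕ => ∑ n ∈ Icc 1 x,
          ∑ e ∈ ((g.eval (n : ℤ)).natAbs).divisors with y x < (g.eval (n : ℤ)).natAbs / e,
            (μ ((g.eval (n : ℤ)).natAbs / e) : ℝ) * Real.log ((((g.eval (n : ℤ)).natAbs / e : ℕ)) : ℝ))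
        =o[atTop] fun x : ℕ => (x : ℝ) :=
  batemanHornAsymptotic_iff_largeDivisorSum_isLittleO_of_properPrimePow hg hdeg.ge
    (properPrimePow_sum_isLittleO_of_natDegree_two hg hdeg) hy hy'

/-- **`BatemanHornAsymptotic ![g] ⟺ T_g(x; x^{1-ε}) = o(x)`** (`0 < ε < 1`) for every quadratic Bateman–Horn
polynomial `g`: the conjunct's instance for `g` is exactly the cancellation of `μ · log` over the divisors
`d > x^{1-ε}` of the values `|g(n)| ≍ x²`. -/
theorem batemanHornAsymptotic_iff_largeDivisorSum_isLittleO_rpowCut_of_natDegree_two {g : ℤ[X]}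
    (hg : IsBatemanHornSystem ![g]) (hdeg : g.natDegree = 2) {ε : ℝ} (hε : 0 < ε) (hε1 : ε < 1) :
    BatemanHornAsymptotic ![g] ↔
      (fun x : ℕ => ∑ n ∈ Icc 1 x,
          ∑ e ∈ ((g.eval (n : ℤ)).natAbs).divisors with ⌊(x : ℝ) ^ (1 - ε)⌋₊ < (g.eval (n : ℤ)).natAbs / e,
            (μ ((g.eval (n : ℤ)).natAbs / e) : ℝ) * Real.log ((((g.eval (n : ℤ)).natAbs / e : ℕ)) : ℝ))
        =o[atTop] fun x : ℕ => (x : ℝ) :=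
  batemanHornAsymptotic_iff_largeDivisorSum_isLittleO_rpowCut_of_properPrimePow hg hdeg.ge
    (properPrimePow_sum_isLittleO_of_natDegree_two hg hdeg) hε hε1

end Summit.Parity.BatemanHorn.Theorems
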